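import Summits.Ventures.PercRepro.CoreFinal
import Summits.Ventures.PercRepro.RLSRulePlus

/-!
# PercRepro — the `q = 3` row from the two core theorems `(7,3)`, `(8,3)` in night-3's `Core` vocabulary (p2, gen 12)

`NightThree.Core M p` (RLSRulePlus) is exactly the hypothesis list of `SmallCoreCellsSevenEight` (simple, rank `p`,
coloop-free, every element with an `e`-free partition). So the moment the two core theorems `Core M 7 → RLS M 7 3`
(p3's lane) and `Core M 8 → RLS M 8 3` (p2's lane) are in the tree, C-025 at `q = 3` on every finite matroid follows
for every `p ≥ 5` by `c025_three_of_core_seven_eight`.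

* `smallCoreCellsSevenEight_of_core` — the bridge;
* **`c025_three_of_core_seven_eight`** — the composition.
Imports `CoreFinal`, `RLSRulePlus`. Axioms: standard.
-/

namespace PercRepro
namespace CoreFour

/-- The two core theorems, in night-3's `Core` vocabulary, give the core statement on `p ∈ {7, 8}`. -/
theorem smallCoreCellsSevenEight_of_core
    (h7 : ∀ {α : Type} (M : Matroid α) [M.Finite], NightThree.Core M 7 → ThmN.RLS M 7 3)
    (h8 : ∀ {α : Type} (M : Matroid α) [M.Finite], NightThree.Core M 8 → ThmN.RLS M 8 3) :
    SmallCoreCellsSevenEight := by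
  intro α M _ p hp hs hrank hcoloop hfree
  rcases hp with rfl | rfl
  · exact h7 M ⟨hs, hrank, hcoloop, hfree⟩
  · exact h8 M ⟨hs, hrank, hcoloop, hfree⟩

/-- **C-025 at `q = 3` on every finite matroid, every `p ≥ 5`, from the core theorems at `p = 7` and `p = 8`.** -/
theorem c025_three_of_core_seven_eight
    (h7 : ∀ {α : Type} (M : Matroid α) [M.Finite], NightThree.Core M 7 → ThmN.RLS M 7 3)
    (h8 : ∀ {α : Type} (M : Matroid α) [M.Finite], NightThree.Core M 8 → ThmN.RLS M 8 3) :
    ∀ {α : Type} (M : Matroid α) [M.Finite] (p : ℕ), 5 ≤ p → ThmN.RLS M p 3 :=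
  c025_three_of_sevenEight (smallCoreCellsSevenEight_of_core h7 h8)

end CoreFour
end PercRepro
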